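import Summits.CriticalPhenomena.SAWScalingLimit.Theorems.SAWLoopFugacityFlowAvoidanceLimitExcursionRatioGreen
import Summits.CriticalPhenomena.SAWScalingLimit.Theorems.SAWLoopFugacityFlowAvoidanceLimitExcursionRatioContinuum
import Literature.Probability.RandomPlanarGeometry.RestrictionHullsRiemannProofs
import Literature.Probability.RandomPlanarGeometry.HullSubdomainPullback
import Literature.Probability.RandomPlanarGeometry.JordanDomainProofs
import Literature.Probability.RandomPlanarGeometry.ChordalCapacityDivergence

/-!
# The `D' = D` instance of the excursion ratio, bookkeeping, and the reduction to an invariance principle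
— helper file 2 of stub `stub_excursionRatio` of line `symplectic-fermion-anchor`
(crux `SAWLoopFugacityFlow.AvoidanceLimit`, stmt-CriticalPhenomena-10649)

The stub `stub_excursionRatio` asserts that along hull data `(D, D', φ, A, Φ, d)` the killed-SRW
Green's-function ratio `greenRatio D D' δ a_δ b_δ` tends to `d = Φ'_A(0)`. This file proves its
degenerate instance `D' = D` (no confinement), where both sides can be computed — a sanity check
of the normalisations, and the two bookkeeping lemmas every proof of the stub starts from:

* `confinedGraph_self_eq` — confining to `closure D` deletes no edge of `D_δ` (the edges of
  `discreteDomainGraph D δ` are closed segments in `closure D` by definition), so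
  `greenRatio D D δ a b = 1` as soon as the denominator is positive (`greenRatio_self_eq_one`);
* `eventually_greenEntry_pos` — along an endpoint approximation (`SAW.IsEndpointApprox`:
  reachability in `D_δ` + convergence of the mesh points to the two DISTINCT marked points) the
  denominator `greenEntry (D_δ) (meshDomainFinset D δ) a_δ b_δ` is eventually positive
  (`greenEntry_pos` of helper file 1: a joining walk of positive length lies in the volume);
* `confinedGraph_adj_iff_of_ball` — ball agreement `D' ∩ B(p,ε) = D ∩ B(p,ε)` makes the confined
  and the unconfined graphs coincide on edges inside `B(p, ε)` (where the hypothesis of the stub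
  enters: the local lattice factors at `a_δ`, `b_δ` cancel), and `greenEntry_sub_greenEntry_eq_sum`
  — the first-deleted-edge (resolvent) decomposition `G_H − G_{H'} = G_{H'}(P_H − P_{H'})G_H`, i.e.
  `1 − greenRatio = P[the excursion uses an edge leaving closure D']`;
* `restrictionDeriv_eq_one_of_self` — for `D' = D` the pulled-back hull
  `A = closure (ℍ ∖ φ⁻¹(D))` is EMPTY (`φ` maps `ℍ` into `D`), a restriction map of `∅` is the
  identity on `ℍ` (uniqueness of `Φ_A`, `IsRestrictionMap.unique`, proved in the tree), hence
  `d = Φ'_∅(0) = 1` (`hasRestrictionDeriv_empty`, `HasRestrictionDeriv.unique`);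
* the registered closing theorem `stub_excursionRatio_self`: the statement of
  `stub_excursionRatio` with `D' := D` (the chordal normalisation of `φ` is not even needed);
* the registered REDUCTION `stub_excursionRatio_of_greenRatioInvariance`: the stub follows from the
  one lattice → continuum input missing from the tree — the Green's-function-ratio invariance
  principle "`greenRatio D D' δ a_δ b_δ − G_{ℍ∖A}(u_δ,v_δ)/G_ℍ(u_δ,v_δ) → 0`" at the uniformized
  legs `u_δ = φ⁻¹(δa_δ) → 0`, `v_δ = φ⁻¹(δb_δ) → ∞` (`tendsto_symm_meshPoint_fst/snd`, inverse
  boundary correspondence of the chordal uniformizer, Carathéodory) — composed with the landed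
  continuum limit `tendsto_greenHalfPlane_ratio` (helper file 3).

Sources: folklore (graph bookkeeping); G. F. Lawler, O. Schramm, W. Werner, *Conformal
restriction: the chordal case*, JAMS 16 (2003), §2 (`Φ_∅ = id`, `Φ'_∅(0) = 1`)
[LawlerSchrammWerner2003Restriction]. No definitions.
-/

noncomputable section

open scoped BigOperators Topology symmDiff
open Filter Finset
open Literature.Probability.RandomPlanarGeometry Literature.Probability.LatticeModels

namespace Summit.CriticalPhenomena.SAWScalingLimit.Theorems.AvoidanceLimit.Anchor

/-! ## Lattice side: no confinement when `S = Ω` -/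

/-- Confining to `closure Ω` deletes no edge of `Ω_δ`: `confinedGraph Ω Ω δ = discreteDomainGraph Ω δ`
(the edges of `Ω_δ` are closed segments inside `closure Ω`, `meshGraph_adj_iff`). [folklore] -/
theorem confinedGraph_self_eq (Ω : Set ℂ) (δ : ℝ) : confinedGraph Ω Ω δ = discreteDomainGraph Ω δ := by
  refine le_antisymm (confinedGraph_le Ω Ω δ) fun x y h => ?_
  rw [confinedGraph, SimpleGraph.fromRel_adj]
  exact ⟨h.ne, Or.inl ⟨h, (meshGraph_adj_iff.1 (discreteDomainGraph_le_meshGraph Ω δ h)).2⟩⟩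

/-- With `S = Ω` the ratio is `1` wherever the denominator is positive. [folklore] -/
theorem greenRatio_self_eq_one {Ω : Set ℂ} {δ : ℝ} {a b : Site 2}
    (h : 0 < greenEntry (discreteDomainGraph Ω δ) (meshDomainFinset Ω δ) a b) :
    greenRatio Ω Ω δ a b = 1 := by
  rw [greenRatio, confinedGraph_self_eq, div_self h.ne']

/-- Every vertex of a walk of `Ω_δ` other than (possibly) its starting point is the head of a dart
of `Ω_δ`, hence lies in the discrete domain `meshDomain Ω δ`. [folklore] -/
theorem mem_meshDomain_of_mem_support {Ω : Set ℂ} {δ : ℝ} {x y : Site 2}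
    (p : (discreteDomainGraph Ω δ).Walk x y) :
    ∀ v ∈ p.support, v = x ∨ v ∈ meshDomain Ω δ := by
  induction p with
  | nil => intro v hv; exact Or.inl (by simpa using hv)
  | @cons u v w huv q ih =>
      intro z hz
      rw [SimpleGraph.Walk.support_cons, List.mem_cons] at hz
      rcases hz with rfl | hz
      · exact Or.inl rfl
      · rcases ih z hz with rfl | hz'
        · exact Or.inr (discreteDomainGraph_adj_iff.1 huv).2.2
        · exact Or.inr hz'

/-- A walk of `Ω_δ` between two DISTINCT vertices lies in the discrete domain `meshDomain Ω δ`
(its starting point is the tail of its first dart). [folklore] -/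
theorem support_subset_meshDomain {Ω : Set ℂ} {δ : ℝ} {x y : Site 2}
    (p : (discreteDomainGraph Ω δ).Walk x y) (hxy : x ≠ y) :
    ∀ v ∈ p.support, v ∈ meshDomain Ω δ := by
  intro v hv
  rcases mem_meshDomain_of_mem_support p v hv with rfl | h
  · obtain ⟨w, hadj, -, -⟩ := p.exists_eq_cons_of_ne hxy
    exact (discreteDomainGraph_adj_iff.1 hadj).2.1
  · exact h

/-- Along an endpoint approximation the two legs are eventually DISTINCT (their mesh points tend to
the two distinct marked points) and both lie in the discrete domain `meshDomain D δ` (they are the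
two ends of a joining walk of positive length), so their mesh points lie in `D`. [folklore] -/
theorem eventually_mem_meshDomain {D : DobrushinDomain} {a b : ℝ → Site 2}
    (hab : SAW.IsEndpointApprox D a b) :
    ∀ᶠ δ in 𝓝[>] (0 : ℝ), a δ ≠ b δ ∧ a δ ∈ meshDomain D.carrier δ ∧ b δ ∈ meshDomain D.carrier δ := by
  have hpq : D.pt 0 ≠ D.pt 1 := fun h => absurd (D.pt_injective h) (by decide)
  have hr : 0 < dist (D.pt 0) (D.pt 1) / 2 := by
    have := dist_pos.2 hpq
    positivity
  have ha := (Metric.tendsto_nhds.1 hab.tendsto_fst) _ hr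
  have hb := (Metric.tendsto_nhds.1 hab.tendsto_snd) _ hr
  filter_upwards [ha, hb, hab.reachable] with δ hδa hδb hreach
  have hne : a δ ≠ b δ := by
    intro heq
    rw [heq] at hδa
    have h3 := dist_triangle (D.pt 0) (meshPoint δ (b δ)) (D.pt 1)
    rw [dist_comm] at hδa
    linarith
  obtain ⟨p⟩ := hreach
  exact ⟨hne, support_subset_meshDomain p hne _ p.start_mem_support,
    support_subset_meshDomain p hne _ p.end_mem_support⟩

/-- **The denominator is eventually positive** along an endpoint approximation: for small `δ > 0`
the legs `a_δ ≠ b_δ` are joined by a walk of `D_δ` of positive length, which lies in the volume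
`meshDomainFinset D δ`, so `greenEntry (D_δ) a_δ b_δ ≥ 4^{-|walk|} > 0` (`greenEntry_pos`). Uses
`IsEndpointApprox.reachable` and the distinctness of the two marked points. [folklore] -/
theorem eventually_greenEntry_pos {D : DobrushinDomain} {a b : ℝ → Site 2}
    (hab : SAW.IsEndpointApprox D a b) :
    ∀ᶠ δ in 𝓝[>] (0 : ℝ),
      0 < greenEntry (discreteDomainGraph D.carrier δ) (meshDomainFinset D.carrier δ) (a δ) (b δ) := by
  have h0 : ∀ᶠ δ in 𝓝[>] (0 : ℝ), 0 < δ := eventually_mem_nhdsWithin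
  filter_upwards [h0, eventually_mem_meshDomain hab, hab.reachable] with δ hδ hne hreach
  obtain ⟨p⟩ := hreach
  refine greenEntry_pos ((discreteDomainGraph_le_meshGraph _ δ).trans (meshGraph_le_zdGraph _ δ)) p
    fun v hv => ?_
  rw [← Finset.mem_coe, coe_meshDomainFinset D.isBounded hδ]
  exact support_subset_meshDomain p hne.1 v hv

/-- Hence `greenRatio D D δ a_δ b_δ = 1` eventually, and the ratio tends to `1`. [folklore] -/
theorem tendsto_greenRatio_self {D : DobrushinDomain} {a b : ℝ → Site 2}
    (hab : SAW.IsEndpointApprox D a b) :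
    Tendsto (fun δ => greenRatio D.carrier D.carrier δ (a δ) (b δ)) (𝓝[>] 0) (𝓝 1) := by
  refine (tendsto_const_nhds (x := (1 : ℝ))).congr' ?_
  filter_upwards [eventually_greenEntry_pos hab] with δ hδ
  exact (greenRatio_self_eq_one hδ).symm

/-! ## Two bookkeeping lemmas every proof of the stub starts from -/

/-- **Ball agreement ⇒ graph agreement near the marked points.** If `D' ∩ B(p, ε) = D ∩ B(p, ε)`,
then an edge of `D_δ` whose closed segment lies in the ball `B(p, ε)` is an edge of the confined
graph `confinedGraph D D' δ` (its segment lies in `closure D ∩ B ⊆ closure (D ∩ B) =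
closure (D' ∩ B) ⊆ closure D'`): inside the two balls of the hypothesis of `stub_excursionRatio`
the confined and the unconfined walks coincide, which is what makes the local lattice factors at
`a_δ`, `b_δ` cancel in the ratio. [folklore] -/
theorem confinedGraph_adj_iff_of_ball {Ω S : Set ℂ} {p : ℂ} {ε δ : ℝ}
    (hball : S ∩ Metric.ball p ε = Ω ∩ Metric.ball p ε) {x y : Site 2}
    (hseg : segment ℝ (meshPoint δ x) (meshPoint δ y) ⊆ Metric.ball p ε) :
    (confinedGraph Ω S δ).Adj x y ↔ (discreteDomainGraph Ω δ).Adj x y := by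
  refine ⟨fun h => confinedGraph_le Ω S δ h, fun h => ?_⟩
  rw [confinedGraph, SimpleGraph.fromRel_adj]
  refine ⟨h.ne, Or.inl ⟨h, fun z hz => ?_⟩⟩
  have hzΩ : z ∈ closure Ω := (meshGraph_adj_iff.1 (discreteDomainGraph_le_meshGraph Ω δ h)).2 hz
  have h1 : z ∈ closure (Ω ∩ Metric.ball p ε) := by
    have := Metric.isOpen_ball.inter_closure (s := Metric.ball p ε) (t := Ω) ⟨hseg hz, hzΩ⟩
    rwa [Set.inter_comm] at this
  rw [← hball] at h1
  exact closure_mono Set.inter_subset_left h1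

/-- **The first-deleted-edge decomposition** (resolvent identity): for `H' ≤ H ≤ ℤ²` and
`a, b ∈ Λ`, `G_H(a,b) − G_{H'}(a,b) = Σ_{u,v ∈ Λ} G_{H'}(a,u) · (P_H − P_{H'})_{uv} · G_H(v,b)`,
where `(P_H − P_{H'})_{uv} = ¼·𝟙[uv ∈ E(H) ∖ E(H')]`: a walk of `H` that is not a walk of `H'`
is split at its FIRST step along a deleted edge (before it: a walk of `H'`; after it: any walk of
`H`). Matrix form: `G_H − G_{H'} = G_{H'} (P_H − P_{H'}) G_H`, from `(1 − P_{H'}) G_{H'} = 1 =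
(1 − P_H) G_H` (`KilledGreen.isUnit_one_sub_transition` of helper file 1). Dividing by `G_H(a,b)`
this is `1 − greenRatio = P[the excursion uses a deleted edge]`, the lattice form of
`P[excursion hits A]`. [cite: Lawler1991, §1.5] -/
theorem greenEntry_sub_greenEntry_eq_sum {H H' : SimpleGraph (Site 2)} (hH : H ≤ zdGraph 2)
    (hH' : H' ≤ H) {Λ : Finset (Site 2)} {a b : Site 2} (ha : a ∈ Λ) (hb : b ∈ Λ) :
    greenEntry H Λ a b - greenEntry H' Λ a b =
      ∑ v : Λ, (∑ u : Λ, greenEntry H' Λ a u *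
        (((4 : ℝ)⁻¹ • adjMat H Λ - (4 : ℝ)⁻¹ • adjMat H' Λ) u v)) * greenEntry H Λ v b := by
  have hU : IsUnit ((1 : Matrix Λ Λ ℝ) - (4 : ℝ)⁻¹ • adjMat H Λ).det :=
    (Matrix.isUnit_iff_isUnit_det _).1 (KilledGreen.isUnit_one_sub_transition Λ hH)
  have hU' : IsUnit ((1 : Matrix Λ Λ ℝ) - (4 : ℝ)⁻¹ • adjMat H' Λ).det :=
    (Matrix.isUnit_iff_isUnit_det _).1 (KilledGreen.isUnit_one_sub_transition Λ (hH'.trans hH))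
  -- the matrix identity `G' (P - P') G = G - G'`
  have key : ((1 : Matrix Λ Λ ℝ) - (4 : ℝ)⁻¹ • adjMat H' Λ)⁻¹ *
      ((4 : ℝ)⁻¹ • adjMat H Λ - (4 : ℝ)⁻¹ • adjMat H' Λ) * ((1 : Matrix Λ Λ ℝ) - (4 : ℝ)⁻¹ • adjMat H Λ)⁻¹ =
      ((1 : Matrix Λ Λ ℝ) - (4 : ℝ)⁻¹ • adjMat H Λ)⁻¹ - ((1 : Matrix Λ Λ ℝ) - (4 : ℝ)⁻¹ • adjMat H' Λ)⁻¹ := by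
    have hsplit : (4 : ℝ)⁻¹ • adjMat H Λ - (4 : ℝ)⁻¹ • adjMat H' Λ =
        ((1 : Matrix Λ Λ ℝ) - (4 : ℝ)⁻¹ • adjMat H' Λ) - ((1 : Matrix Λ Λ ℝ) - (4 : ℝ)⁻¹ • adjMat H Λ) := by
      abel
    rw [hsplit, Matrix.mul_sub, Matrix.sub_mul, Matrix.nonsing_inv_mul _ hU', Matrix.one_mul,
      Matrix.mul_assoc, Matrix.mul_nonsing_inv _ hU, Matrix.mul_one]
  -- read off the `(a, b)` entry
  have hab : ∀ (X : SimpleGraph (Site 2)) (u v : Λ),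
      greenEntry X Λ u v = ((1 : Matrix Λ Λ ℝ) - (4 : ℝ)⁻¹ • adjMat X Λ)⁻¹ u v := fun X u v => by
    rw [greenEntry, dif_pos ⟨u.2, v.2⟩]
  have hEntry := congr_fun (congr_fun key ⟨a, ha⟩) ⟨b, hb⟩
  rw [Matrix.sub_apply, Matrix.mul_apply] at hEntry
  simp only [Matrix.mul_apply] at hEntry
  rw [hab H ⟨a, ha⟩ ⟨b, hb⟩, hab H' ⟨a, ha⟩ ⟨b, hb⟩, ← hEntry]
  refine Finset.sum_congr rfl fun v _ => ?_
  rw [hab H v ⟨b, hb⟩]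
  refine congrArg (· * _) (Finset.sum_congr rfl fun u _ => ?_)
  rw [hab H' ⟨a, ha⟩ u]

/-! ## Continuum side: the pulled-back hull of `D` itself is empty and `Φ'_∅(0) = 1` -/

/-- **`Φ'_∅(0) = 1` for every restriction map of the empty hull**: a restriction map of `∅` is the
identity on `ℍ` (uniqueness of `Φ_A`, [LSW] §2 p. 8, the tree's `IsRestrictionMap.unique` with
`isRestrictionMap_empty`), so `Φ(z)/z = 1` on `ℍ` and the limit `d` is `1`
(`hasRestrictionDeriv_empty`, `HasRestrictionDeriv.unique`).
[cite: LawlerSchrammWerner2003Restriction, §2 p. 8 (the normalized conformal maps Φ_A)] -/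
theorem restrictionDeriv_empty_eq_one
    {Φ : ConformalEquiv (UpperHalfPlane.upperHalfPlaneSet \ ∅) UpperHalfPlane.upperHalfPlaneSet}
    {d : ℝ} (hΦ : IsRestrictionMap ∅ Φ) (hd : HasRestrictionDeriv ∅ Φ d) : d = 1 := by
  have hEq : Set.EqOn Φ restrictionMapEmpty (UpperHalfPlane.upperHalfPlaneSet \ ∅) :=
    IsRestrictionMap.unique isStarHull_empty isRestrictionMap_empty hΦ
  have h1 : HasRestrictionDeriv ∅ Φ 1 := by
    refine hasRestrictionDeriv_empty.congr' ?_
    filter_upwards [self_mem_nhdsWithin] with z hz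
    rw [hEq hz]
  exact hd.unique isStarHull_empty h1

/-- For `D' = D`: whatever the uniformizer `φ : ℍ → D`, the hull `A = closure (ℍ ∖ φ⁻¹ D)` is empty
and every restriction datum `(Φ, d)` of `A` has `d = 1`. [folklore] -/
theorem restrictionDeriv_eq_one_of_self {V : Set ℂ}
    (φ : ConformalEquiv UpperHalfPlane.upperHalfPlaneSet V) {A : Set ℂ}
    (hA : A = closure (UpperHalfPlane.upperHalfPlaneSet \
      {z | z ∈ UpperHalfPlane.upperHalfPlaneSet ∧ φ z ∈ V}))
    {Φ : ConformalEquiv (UpperHalfPlane.upperHalfPlaneSet \ A) UpperHalfPlane.upperHalfPlaneSet}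
    {d : ℝ} (hΦ : IsRestrictionMap A Φ) (hd : HasRestrictionDeriv A Φ d) : d = 1 := by
  -- the pulled-back hull of `V` itself is empty: `φ` maps `ℍ` into `V`
  have hempty : closure (UpperHalfPlane.upperHalfPlaneSet \
      {z | z ∈ UpperHalfPlane.upperHalfPlaneSet ∧ φ z ∈ V}) = ∅ := by
    rw [closure_empty_iff, Set.sdiff_eq_empty]
    exact fun z hz => ⟨hz, φ.mapsTo hz⟩
  rw [hempty] at hA
  subst hA
  exact restrictionDeriv_empty_eq_one hΦ hd

/-! ## The registered closing theorem: `stub_excursionRatio` at `D' = D` -/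

/-- **`stub_excursionRatio` in the degenerate case `D' = D`** (registered sub-goal of the stub): with
no confinement the Green's-function ratio is eventually `1` (`tendsto_greenRatio_self`) and the
restriction exponent datum is `d = Φ'_∅(0) = 1` (`restrictionDeriv_eq_one_of_self`), so the ratio
tends to `d`. The chordal normalisation of `φ` is not needed for this instance. [folklore] -/
theorem stub_excursionRatio_self :
    ∀ (D : DobrushinDomain) (a b : ℝ → Site 2), SAW.IsEndpointApprox D a b →
      ∀ (φ : ConformalEquiv UpperHalfPlane.upperHalfPlaneSet D.carrier) (A : Set ℂ),
      A = closure (UpperHalfPlane.upperHalfPlaneSet \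
        {z | z ∈ UpperHalfPlane.upperHalfPlaneSet ∧ φ z ∈ D.carrier}) →
      ∀ (Φ : ConformalEquiv (UpperHalfPlane.upperHalfPlaneSet \ A) UpperHalfPlane.upperHalfPlaneSet)
        (d : ℝ), IsRestrictionMap A Φ → HasRestrictionDeriv A Φ d →
      Tendsto (fun δ => greenRatio D.carrier D.carrier δ (a δ) (b δ)) (𝓝[>] 0) (𝓝 d) := by
  intro D a b hab φ A hA Φ d hΦ hd
  rw [restrictionDeriv_eq_one_of_self φ hA hΦ hd]
  exact tendsto_greenRatio_self hab

/-! ## The reduction: `stub_excursionRatio` = (Green's-ratio invariance principle) ∘ (continuum ratio) -/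

/-- **The uniformized legs tend to `0` and `∞` inside `ℍ ∖ A`.** Along an endpoint approximation
of `(D; a, b)` with hull subdomain `D'` (ball agreement near `a`) and chordal uniformizer `φ`, the
point `u_δ = φ⁻¹(δ a_δ)` tends to `0` within `ℍ ∖ A` (inverse boundary correspondence of `φ` at `a`,
Carathéodory — the tree's `IsChordalUniformizing.tendsto_symm_nhds_zero`; `u_δ ∉ A` because
`δ a_δ ∈ D ∩ B(a, ε) ⊆ D'`). [cite: PommerenkeBBCM1992, Thm. 2.6] -/
theorem tendsto_symm_meshPoint_fst {D D' : DobrushinDomain} {a b : ℝ → Site 2}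
    (hab : SAW.IsEndpointApprox D a b) (hsub : D'.carrier ⊆ D.carrier)
    {ε : ℝ} (hε : 0 < ε) (hb0 : D'.carrier ∩ Metric.ball (D.pt 0) ε = D.carrier ∩ Metric.ball (D.pt 0) ε)
    {φ : ConformalEquiv UpperHalfPlane.upperHalfPlaneSet D.carrier} (hφ : D.IsChordalUniformizing φ) :
    Tendsto (fun δ => φ.symm (meshPoint δ (a δ))) (𝓝[>] 0)
      (𝓝[UpperHalfPlane.upperHalfPlaneSet \ φ.pullbackHull D'] 0) := by
  have hD : ∀ᶠ δ in 𝓝[>] (0 : ℝ), meshPoint δ (a δ) ∈ D.carrier :=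
    (eventually_mem_meshDomain hab).mono fun δ h => meshDomain_subset_meshVertices _ _ h.2.1
  have hin : Tendsto (fun δ => meshPoint δ (a δ)) (𝓝[>] 0) (𝓝[D.carrier] (D.pt 0)) :=
    tendsto_nhdsWithin_iff.2 ⟨hab.tendsto_fst, hD⟩
  refine tendsto_nhdsWithin_iff.2 ⟨hφ.tendsto_symm_nhds_zero.comp hin, ?_⟩
  have hball : ∀ᶠ δ in 𝓝[>] (0 : ℝ), meshPoint δ (a δ) ∈ Metric.ball (D.pt 0) ε :=
    hab.tendsto_fst (Metric.ball_mem_nhds _ hε)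
  filter_upwards [hD, hball] with δ hδD hδb
  have hD' : meshPoint δ (a δ) ∈ D'.carrier := by
    have : meshPoint δ (a δ) ∈ D'.carrier ∩ Metric.ball (D.pt 0) ε := by rw [hb0]; exact ⟨hδD, hδb⟩
    exact this.1
  rw [ConformalEquiv.diff_pullbackHull]
  exact ConformalEquiv.symm_mapsTo_pullbackDomain hsub hD'

/-- **… and `v_δ = φ⁻¹(δ b_δ)` tends to `∞` within `ℍ ∖ A`** (inverse boundary correspondence of
`φ` at `b`, `IsChordalUniformizing.tendsto_symm_cocompact`; ball agreement near `b`).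
[cite: PommerenkeBBCM1992, Thm. 2.6] -/
theorem tendsto_symm_meshPoint_snd {D D' : DobrushinDomain} {a b : ℝ → Site 2}
    (hab : SAW.IsEndpointApprox D a b) (hsub : D'.carrier ⊆ D.carrier)
    {ε : ℝ} (hε : 0 < ε) (hb1 : D'.carrier ∩ Metric.ball (D.pt 1) ε = D.carrier ∩ Metric.ball (D.pt 1) ε)
    {φ : ConformalEquiv UpperHalfPlane.upperHalfPlaneSet D.carrier} (hφ : D.IsChordalUniformizing φ) :
    Tendsto (fun δ => φ.symm (meshPoint δ (b δ))) (𝓝[>] 0)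
      (cocompact ℂ ⊓ 𝓟 (UpperHalfPlane.upperHalfPlaneSet \ φ.pullbackHull D')) := by
  have hD : ∀ᶠ δ in 𝓝[>] (0 : ℝ), meshPoint δ (b δ) ∈ D.carrier :=
    (eventually_mem_meshDomain hab).mono fun δ h => meshDomain_subset_meshVertices _ _ h.2.2
  have hin : Tendsto (fun δ => meshPoint δ (b δ)) (𝓝[>] 0) (𝓝[D.carrier] (D.pt 1)) :=
    tendsto_nhdsWithin_iff.2 ⟨hab.tendsto_snd, hD⟩
  refine tendsto_inf.2 ⟨hφ.tendsto_symm_cocompact.comp hin, tendsto_principal.2 ?_⟩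
  have hball : ∀ᶠ δ in 𝓝[>] (0 : ℝ), meshPoint δ (b δ) ∈ Metric.ball (D.pt 1) ε :=
    hab.tendsto_snd (Metric.ball_mem_nhds _ hε)
  filter_upwards [hD, hball] with δ hδD hδb
  have hD' : meshPoint δ (b δ) ∈ D'.carrier := by
    have : meshPoint δ (b δ) ∈ D'.carrier ∩ Metric.ball (D.pt 1) ε := by rw [hb1]; exact ⟨hδD, hδb⟩
    exact this.1
  rw [ConformalEquiv.diff_pullbackHull]
  exact ConformalEquiv.symm_mapsTo_pullbackDomain hsub hD'

/-- **REDUCTION (registered sub-goal): `stub_excursionRatio` follows from the Green's-function-ratio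
invariance principle.** The hypothesis is the ONE lattice → continuum input that is not in the
tree: along the hull data of the stub, the killed-SRW ratio `greenRatio D D' δ a_δ b_δ` is
asymptotic to the ratio of CONTINUUM Green's functions `G_{ℍ∖A}(u_δ, v_δ)/G_ℍ(u_δ, v_δ)` at the
uniformized legs `u_δ = φ⁻¹(δa_δ)`, `v_δ = φ⁻¹(δb_δ)` (conformal invariance of the continuum Green's
function is built into this phrasing) — an invariance principle for the simple random walk killed
outside a rough (Jordan) lattice domain, in RATIO form, uniform down to the two marked prime ends
(print: Kozdron–Lawler 2005, EJP 10, Thm. 1.1 / Prop. 3.10 for grid domains with macroscopically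
separated boundary points, together with a `δ`-uniform boundary Harnack principle, Chelkak 2016,
Thm. 3.13-type; NOT vendored). Given it, the stub is the landed continuum limit
`tendsto_greenHalfPlane_ratio` (helper file 3) at `(u_δ, v_δ) → (0, ∞)` inside `ℍ ∖ A`
(`tendsto_symm_meshPoint_fst/snd`), `A` being a `*`-hull (`IsStarHull.pullbackHull`).
[cite: KozdronLawler2005, Thm. 1.1] -/
theorem stub_excursionRatio_of_greenRatioInvariance :
    (∀ (D D' : DobrushinDomain) (a b : ℝ → Site 2), SAW.IsEndpointApprox D a b →
      D'.carrier ⊆ D.carrier → D'.pt 0 = D.pt 0 → D'.pt 1 = D.pt 1 →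
      (∃ ε : ℝ, 0 < ε ∧ D'.carrier ∩ Metric.ball (D.pt 0) ε = D.carrier ∩ Metric.ball (D.pt 0) ε ∧
        D'.carrier ∩ Metric.ball (D.pt 1) ε = D.carrier ∩ Metric.ball (D.pt 1) ε) →
      ∀ (φ : ConformalEquiv UpperHalfPlane.upperHalfPlaneSet D.carrier), D.IsChordalUniformizing φ →
      ∀ (A : Set ℂ), A = closure (UpperHalfPlane.upperHalfPlaneSet \
        {z | z ∈ UpperHalfPlane.upperHalfPlaneSet ∧ φ z ∈ D'.carrier}) →
      ∀ (Φ : ConformalEquiv (UpperHalfPlane.upperHalfPlaneSet \ A) UpperHalfPlane.upperHalfPlaneSet),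
        IsRestrictionMap A Φ →
      Tendsto (fun δ => greenRatio D.carrier D'.carrier δ (a δ) (b δ) -
        Real.log (‖Φ (φ.symm (meshPoint δ (a δ))) - (starRingEnd ℂ) (Φ (φ.symm (meshPoint δ (b δ))))‖ /
            ‖Φ (φ.symm (meshPoint δ (a δ))) - Φ (φ.symm (meshPoint δ (b δ)))‖) /
          Real.log (‖φ.symm (meshPoint δ (a δ)) - (starRingEnd ℂ) (φ.symm (meshPoint δ (b δ)))‖ /
            ‖φ.symm (meshPoint δ (a δ)) - φ.symm (meshPoint δ (b δ))‖)) (𝓝[>] 0) (𝓝 0)) →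
    ∀ (D D' : DobrushinDomain) (a b : ℝ → Site 2), SAW.IsEndpointApprox D a b →
      D'.carrier ⊆ D.carrier → D'.pt 0 = D.pt 0 → D'.pt 1 = D.pt 1 →
      (∃ ε : ℝ, 0 < ε ∧ D'.carrier ∩ Metric.ball (D.pt 0) ε = D.carrier ∩ Metric.ball (D.pt 0) ε ∧
        D'.carrier ∩ Metric.ball (D.pt 1) ε = D.carrier ∩ Metric.ball (D.pt 1) ε) →
      ∀ (φ : ConformalEquiv UpperHalfPlane.upperHalfPlaneSet D.carrier), D.IsChordalUniformizing φ →
      ∀ (A : Set ℂ), A = closure (UpperHalfPlane.upperHalfPlaneSet \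
        {z | z ∈ UpperHalfPlane.upperHalfPlaneSet ∧ φ z ∈ D'.carrier}) →
      ∀ (Φ : ConformalEquiv (UpperHalfPlane.upperHalfPlaneSet \ A) UpperHalfPlane.upperHalfPlaneSet)
        (d : ℝ), IsRestrictionMap A Φ → HasRestrictionDeriv A Φ d →
      Tendsto (fun δ => greenRatio D.carrier D'.carrier δ (a δ) (b δ)) (𝓝[>] 0) (𝓝 d) := by
  intro hX D D' a b hab hsub h0 h1 hball φ hφ A hA Φ d hΦ hd
  have hdiff := hX D D' a b hab hsub h0 h1 hball φ hφ A hA Φ hΦ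
  obtain ⟨ε, hε, hb0, hb1⟩ := hball
  -- ball agreement ⇒ the marked points are off `closure (D ∖ D')`: `D'` is a hull subdomain
  have hHull : D.IsHullSubdomain D' := by
    have key : ∀ p : ℂ, D'.carrier ∩ Metric.ball p ε = D.carrier ∩ Metric.ball p ε →
        p ∉ closure (D.carrier \ D'.carrier) := by
      intro p hp hmem
      rw [mem_closure_iff_nhds] at hmem
      obtain ⟨z, hzb, hzD, hzD'⟩ := hmem (Metric.ball p ε) (Metric.ball_mem_nhds p hε)
      have hz : z ∈ D'.carrier ∩ Metric.ball p ε := by rw [hp]; exact ⟨hzD, hzb⟩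
      exact hzD' hz.1
    exact ⟨hsub, h0, h1, key _ hb0, key _ hb1⟩
  have hA' : A = φ.pullbackHull D' := hA
  subst hA'
  have hstar : IsStarHull (φ.pullbackHull D') :=
    IsStarHull.pullbackHull JordanDomain.isSimplyConnected_holds hφ hHull
  -- the continuum ratio at the uniformized legs tends to `d`
  have hcont := (tendsto_greenHalfPlane_ratio _ hstar Φ d hΦ hd).comp
    ((tendsto_symm_meshPoint_fst hab hsub hε hb0 hφ).prodMk
      (tendsto_symm_meshPoint_snd hab hsub hε hb1 hφ))
  have hsum := hdiff.add hcont
  rw [zero_add] at hsum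
  refine hsum.congr fun δ => ?_
  simp only [Function.comp_apply, sub_add_cancel]

end Summit.CriticalPhenomena.SAWScalingLimit.Theorems.AvoidanceLimit.Anchor

end
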